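import Summits.ResolutionOfSingularities.ResolutionOfSingularities.Theorems.WildConesCampaignW46HypersurfacesCharTwoEmbDimStates
import Mathlib.LinearAlgebra.Matrix.Rank

/-!
# [OURS · L1 W4.6, rung (ii) at p = 2, EVERY dimension n] THE EMBEDDING DIMENSION OF A DOUBLE POINT IS
# THE CORANK OF ITS POLAR FORM: `e(c) + rank (polarMatrix a) = n`, the rank is EVEN, and the full-rank
# criteria for the regime `e ≤ 1` and for `e = 0` — over every field of characteristic 2

HONEST FRAMING. Everything here is OURS: bookkeeping theorems about route WildCones' own TYPED point-blow-up
dynamics (`Theorems/WildConesClassicalRegimesDefs.lean`) and the seat's invariant `CampaignW46.milnorEmbDim`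
(`Theorems/WildConesCampaignW46HypersurfacesCharTwoEmbDimDefs.lean`, p498937), whose docstring ANNOUNCES that
the embedding dimension `e(c)` of the Milnor algebra of a double point `z² = a(u₁,…,uₙ)` in characteristic `2`
equals `n −` the rank of the polar (alternating) matrix `([u_s u_t] a)_{s ≠ t}` of the cleaned quadratic part.
This file makes that announcement a kernel fact, so that the regime «`e ≤ 1`» of
`…HypersurfacesCharTwoEmbDim{,States,Dynamics}.lean` (p500816, p501431, p501990) reads as the FULL-RANK
CRITERION «polar form of corank `≤ 1`» and `e = 0` as «polar form non-degenerate». Two bookkeeping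
definitions (`linPartials`, `polarMatrix`: explicit matrices of coefficients) and seven theorems; nothing
here is a statement of the manuscript [Hironaka2017]; no FACT-LIST premise; AI review is weaker than
expert review. Cell res-hironaka (LADDER-RESOLUTION rung L, D-0089), slot W4.6, seat res-L1-s46-pv-4
(gen 3); host route `WildCones`, crux `ClassicalRegimes` (stmt-ResolutionOfSingularities-16884; proved).

WHAT IS PROVED (linear algebra over any field `κ`, then characteristic `2`):

* `jetTwoColength_add_rank_linPartials` — for `f ∈ κ⟦X₁,…,Xₙ⟧` without linear terms,
  `dim_κ κ⟦X⟧/((∂f) + 𝔪²) + rank (linPartials f) = n + 1`, `linPartials f s t = [X_t] ∂ₛ f`: rank–nullity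
  for `κ⟦X⟧/𝔪² → κ⟦X⟧/((∂f) + 𝔪²)` (kernel = the `κ`-span of the classes of the partials,
  `ker_factor_eq_span`) and for the two linear-combination maps `c ↦ Σ cₛ [∂ₛ f]`, `c ↦ Σ cₛ · (row s)`,
  which have the same kernel (`finrank_span_mk_pderiv_eq_rank`).
* `linPartials_eq_polarMatrix` — in characteristic two `[X_t] ∂ₛ f = [X_s X_t] f` (`s ≠ t`) and
  `[X_s] ∂ₛ f = 0`: the matrix of linear parts IS the polar matrix; `jetTwoColength_add_rank_polarMatrix`.
* `milnorEmbDim_add_rank_polarMatrix` — for a double state `c` (cleaned series `a`):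
  `e(c) + rank (polarMatrix a) = n`; `even_rank_polarMatrix` — the rank is EVEN (`e ≡ n (mod 2)`,
  p501431); `milnorEmbDim_le_one_iff_rank` — `e ≤ 1 ↔ n ≤ rank + 1` and `e = 0 ↔ rank = n`.

References: G.-M. Greuel, G. Pfister, J. Algebra 689 (2026) [GreuelPfister2026] (context); H. Hironaka, ms.
2017 [Hironaka2017] — none of it used.
-/

noncomputable section

-- single-problem summit: the doubled namespace component `ResolutionOfSingularities` is forced
set_option linter.dupNamespace false

open scoped BigOperators Classical

open MvPowerSeries IsLocalRing

open Literature.AlgebraicGeometry.Resolution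

namespace Summit.ResolutionOfSingularities.ResolutionOfSingularities.Theorems

namespace CampaignW46.HypersurfacesCharTwo

open WildCones WildCones.MuDropCharTwoOrdP ThreefoldsCharTwo

variable {κ : Type} [Field κ] {n : ℕ}

/-- [OURS · L1 W4.6] **The matrix of linear parts of the partials**: `linPartials f s t = [X_t] ∂ₛ f` —
the `s`-th row is the linear part of `∂ₛ f` (over any field: `(1 + δ_{st}) · [X_s X_t] f`). [folklore] -/
def linPartials (f : MvPowerSeries (Fin n) κ) : Matrix (Fin n) (Fin n) κ :=
  Matrix.of fun s t => coeff (Finsupp.single t 1) (MvPowerSeries.pderiv s f)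

/-- [OURS · L1 W4.6] **The polar matrix** of the quadratic part of `f`: `polarMatrix f s t = [X_s X_t] f`
for `s ≠ t` and `0` on the diagonal — the matrix of the polar (alternating, in characteristic two)
bilinear form of the quadratic form `Σ_{s<t} [X_s X_t] f · X_s X_t`. [folklore] -/
def polarMatrix (f : MvPowerSeries (Fin n) κ) : Matrix (Fin n) (Fin n) κ :=
  Matrix.of fun s t => if s = t then 0 else coeff (Finsupp.single s 1 + Finsupp.single t 1) f

/-- [OURS · L1 W4.6] In characteristic two the linear parts of the partials ARE the polar matrix:
`[X_t] ∂ₛ f = [X_s X_t] f` for `s ≠ t` and `[X_s] ∂ₛ f = 2 [X_s²] f = 0`. [folklore] -/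
theorem linPartials_eq_polarMatrix [CharP κ 2] (f : MvPowerSeries (Fin n) κ) :
    linPartials f = polarMatrix f := by
  ext s t
  simp only [linPartials, polarMatrix, Matrix.of_apply]
  rw [coeff_single_pderiv, Finsupp.single_apply]
  by_cases h : s = t
  · subst h
    rw [if_pos rfl, if_pos rfl, Nat.cast_one, CharTwo.add_self_eq_zero, zero_mul]
  · rw [if_neg (Ne.symm h), if_neg h, Nat.cast_zero, zero_add, one_mul, add_comm]

/-- The kernel of `κ⟦X⟧/𝔪² → κ⟦X⟧/((∂f) + 𝔪²)` is the `κ`-span of the classes of the partials, when the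
partials have no constant term. [folklore] -/
theorem ker_factor_eq_span {f : MvPowerSeries (Fin n) κ} (hf : ∀ s, coeff (Finsupp.single s 1) f = 0) :
    LinearMap.ker (Ideal.Quotient.factorₐ κ (le_sup_right :
        maximalIdeal (MvPowerSeries (Fin n) κ) ^ 2 ≤
          Ideal.span (Set.range fun s => MvPowerSeries.pderiv s f) ⊔
            maximalIdeal (MvPowerSeries (Fin n) κ) ^ 2)).toLinearMap =
      Submodule.span κ (Set.range fun s =>
        Ideal.Quotient.mk (maximalIdeal (MvPowerSeries (Fin n) κ) ^ 2) (MvPowerSeries.pderiv s f)) := by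
  set M2 := maximalIdeal (MvPowerSeries (Fin n) κ) ^ 2 with hM2
  set J := Ideal.span (Set.range fun s => MvPowerSeries.pderiv s f) with hJ
  have hdm : ∀ s, MvPowerSeries.pderiv s f ∈ maximalIdeal (MvPowerSeries (Fin n) κ) := fun s => by
    rw [Literature.RingTheory.MvPowerSeries.Jets.mem_maximalIdeal_iff_constantCoeff_eq_zero,
      constantCoeff_pderiv, hf s]
  apply le_antisymm
  · intro v hv
    rw [LinearMap.mem_ker] at hv
    obtain ⟨g, rfl⟩ := Ideal.Quotient.mk_surjective v
    have hg : g ∈ J ⊔ M2 := by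
      rw [← Ideal.Quotient.eq_zero_iff_mem]
      exact hv
    obtain ⟨j, hj, m, hm, rfl⟩ := Submodule.mem_sup.mp hg
    obtain ⟨c, rfl⟩ := (Submodule.mem_span_range_iff_exists_fun _).mp hj
    have hm0 : Ideal.Quotient.mk M2 m = 0 := Ideal.Quotient.eq_zero_iff_mem.mpr hm
    rw [map_add, hm0, add_zero, map_sum]
    refine Submodule.sum_mem _ fun s _ => ?_
    have hsplit : c s • MvPowerSeries.pderiv s f =
        C (constantCoeff (c s)) * MvPowerSeries.pderiv s f +
          (c s - C (constantCoeff (c s))) * MvPowerSeries.pderiv s f := by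
      rw [smul_eq_mul]; ring
    have hmem2 : (c s - C (constantCoeff (c s))) * MvPowerSeries.pderiv s f ∈ M2 := by
      rw [hM2, pow_two]
      refine Ideal.mul_mem_mul ?_ (hdm s)
      rw [Literature.RingTheory.MvPowerSeries.Jets.mem_maximalIdeal_iff_constantCoeff_eq_zero, map_sub,
        constantCoeff_C, sub_self]
    rw [hsplit, map_add, Ideal.Quotient.eq_zero_iff_mem.mpr hmem2, add_zero, map_mul,
      MvPowerSeries.c_eq_algebraMap, Ideal.Quotient.mk_algebraMap, ← Algebra.smul_def]
    exact Submodule.smul_mem _ _ (Submodule.subset_span ⟨s, rfl⟩)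
  · rw [Submodule.span_le]
    rintro _ ⟨s, rfl⟩
    rw [SetLike.mem_coe, LinearMap.mem_ker]
    change Ideal.Quotient.factorₐ κ le_sup_right (Ideal.Quotient.mk M2 (MvPowerSeries.pderiv s f)) = 0
    rw [Ideal.Quotient.factorₐ_apply, Ideal.Quotient.factor_mk, Ideal.Quotient.eq_zero_iff_mem]
    exact Ideal.mem_sup_left (Ideal.subset_span ⟨s, rfl⟩)

/-- Rank–nullity for `κ⟦X⟧/𝔪² → κ⟦X⟧/((∂f) + 𝔪²)`: `jetTwoColength f + dim_κ ⟨classes of the partials⟩ = n + 1`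
(partials without constant term). [folklore] -/
theorem jetTwoColength_add_finrank_span {f : MvPowerSeries (Fin n) κ}
    (hf : ∀ s, coeff (Finsupp.single s 1) f = 0) :
    jetTwoColength f + Module.finrank κ (Submodule.span κ (Set.range fun s =>
      Ideal.Quotient.mk (maximalIdeal (MvPowerSeries (Fin n) κ) ^ 2) (MvPowerSeries.pderiv s f))) =
      n + 1 := by
  have hle : maximalIdeal (MvPowerSeries (Fin n) κ) ^ 2 ≤
      Ideal.span (Set.range fun s => MvPowerSeries.pderiv s f) ⊔
        maximalIdeal (MvPowerSeries (Fin n) κ) ^ 2 := le_sup_right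
  haveI : Module.Finite κ (MvPowerSeries (Fin n) κ ⧸ maximalIdeal (MvPowerSeries (Fin n) κ) ^ 2) :=
    Module.finite_of_finrank_pos (by rw [finrank_quot_maximalIdeal_sq]; omega)
  have hsurj : Function.Surjective (Ideal.Quotient.factorₐ κ hle).toLinearMap := by
    intro x
    obtain ⟨a, rfl⟩ := Ideal.Quotient.mk_surjective x
    exact ⟨Ideal.Quotient.mk _ a, rfl⟩
  have h := LinearMap.finrank_range_add_finrank_ker (Ideal.Quotient.factorₐ κ hle).toLinearMap
  rw [LinearMap.range_eq_top.mpr hsurj, finrank_top, finrank_quot_maximalIdeal_sq,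
    ker_factor_eq_span hf] at h
  exact h

/-- The `κ`-span of the classes of the partials in `κ⟦X⟧/𝔪²` has dimension the RANK of the matrix of
their linear parts (two rank–nullity counts with the same kernel: `Σ cₛ ∂ₛ f ∈ 𝔪²` iff `Σ cₛ · (linear part
of ∂ₛ f) = 0`). [folklore] -/
theorem finrank_span_mk_pderiv_eq_rank {f : MvPowerSeries (Fin n) κ}
    (hf : ∀ s, coeff (Finsupp.single s 1) f = 0) :
    Module.finrank κ (Submodule.span κ (Set.range fun s =>
      Ideal.Quotient.mk (maximalIdeal (MvPowerSeries (Fin n) κ) ^ 2) (MvPowerSeries.pderiv s f))) =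
      (linPartials f).rank := by
  set M2 := maximalIdeal (MvPowerSeries (Fin n) κ) ^ 2 with hM2
  set v : Fin n → MvPowerSeries (Fin n) κ ⧸ M2 :=
    fun s => Ideal.Quotient.mk M2 (MvPowerSeries.pderiv s f) with hv
  set w : Fin n → (Fin n → κ) := fun s => linPartials f s with hw
  -- the combination `Σ cₛ ∂ₛ f` and its linear part
  have hcomb : ∀ c : Fin n → κ, (∑ i, c i • v i) =
      Ideal.Quotient.mk M2 (∑ i, C (c i) * MvPowerSeries.pderiv i f) := by
    intro c
    rw [map_sum]
    refine Finset.sum_congr rfl fun i _ => ?_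
    rw [map_mul, MvPowerSeries.c_eq_algebraMap, Ideal.Quotient.mk_algebraMap, ← Algebra.smul_def]
  have hlin : ∀ (c : Fin n → κ) (t : Fin n),
      coeff (Finsupp.single t 1) (∑ i, C (c i) * MvPowerSeries.pderiv i f) = (∑ i, c i • w i) t := by
    intro c t
    rw [map_sum, Finset.sum_apply]
    refine Finset.sum_congr rfl fun i _ => ?_
    rw [MvPowerSeries.coeff_C_mul, Pi.smul_apply, smul_eq_mul]
    rfl
  have hconst : ∀ c : Fin n → κ,
      coeff (0 : Fin n →₀ ℕ) (∑ i, C (c i) * MvPowerSeries.pderiv i f) = 0 := by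
    intro c
    rw [map_sum]
    refine Finset.sum_eq_zero fun i _ => ?_
    rw [MvPowerSeries.coeff_C_mul, coeff_zero_eq_constantCoeff_apply, constantCoeff_pderiv, hf i,
      mul_zero]
  have hker : LinearMap.ker (Fintype.linearCombination κ v) =
      LinearMap.ker (Fintype.linearCombination κ w) := by
    ext c
    simp only [LinearMap.mem_ker, Fintype.linearCombination_apply]
    rw [hcomb, Ideal.Quotient.eq_zero_iff_mem,
      Literature.RingTheory.MvPowerSeries.Jets.mem_maximalIdeal_pow_iff]
    constructor
    · intro h
      funext t
      rw [← hlin, Pi.zero_apply]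
      exact h (Finsupp.single t 1) (by rw [Finsupp.degree_single]; omega)
    · intro h e he
      have hdeg : e.degree = 0 ∨ e.degree = 1 := by omega
      rcases hdeg with h0 | h1
      · rw [Finsupp.degree_eq_zero_iff] at h0
        subst h0
        exact hconst c
      · obtain ⟨t, rfl⟩ := exists_eq_single_of_degree_eq_one h1
        rw [hlin, h, Pi.zero_apply]
  have h1 := LinearMap.finrank_range_add_finrank_ker (Fintype.linearCombination κ v)
  have h2 := LinearMap.finrank_range_add_finrank_ker (Fintype.linearCombination κ w)
  rw [Fintype.range_linearCombination, Module.finrank_fin_fun] at h1 h2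
  rw [hker] at h1
  rw [Matrix.rank_eq_finrank_span_row]
  change Module.finrank κ (Submodule.span κ (Set.range v)) =
    Module.finrank κ (Submodule.span κ (Set.range w))
  omega

/-- [OURS · L1 W4.6; NOT a statement of the manuscript] **`jetTwoColength` COUNTS THE CORANK of the
linear parts of the partials** (any field, `f` without linear terms): `dim_κ κ⟦X⟧/((∂f) + 𝔪²) + rank
(linPartials f) = n + 1`, i.e. the embedding dimension of the Milnor algebra is `n − rank (linPartials f)`.
[folklore] -/
theorem jetTwoColength_add_rank_linPartials {f : MvPowerSeries (Fin n) κ}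
    (hf : ∀ s, coeff (Finsupp.single s 1) f = 0) :
    jetTwoColength f + (linPartials f).rank = n + 1 := by
  rw [← finrank_span_mk_pderiv_eq_rank hf]
  exact jetTwoColength_add_finrank_span hf

/-- [OURS · L1 W4.6; NOT a statement of the manuscript] Characteristic two: `jetTwoColength f + rank
(polarMatrix f) = n + 1` for `f` without linear terms. [folklore] -/
theorem jetTwoColength_add_rank_polarMatrix [CharP κ 2] {f : MvPowerSeries (Fin n) κ}
    (hf : ∀ s, coeff (Finsupp.single s 1) f = 0) :
    jetTwoColength f + (polarMatrix f).rank = n + 1 := by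
  rw [← linPartials_eq_polarMatrix]
  exact jetTwoColength_add_rank_linPartials hf

/-- [OURS · L1 W4.6; NOT a statement of the manuscript] **THE EMBEDDING DIMENSION OF A DOUBLE POINT IS
THE CORANK OF ITS POLAR FORM** (`z² = a(u₁,…,uₙ)`, any field of characteristic `2`): for a state of
multiplicity two, `e(c) + rank (polarMatrix a) = n`, `a` the cleaned series — the number announced in
the docstring of `CampaignW46.milnorEmbDim` (p498937) is a kernel fact. [folklore] -/
theorem milnorEmbDim_add_rank_polarMatrix [CharP κ 2] {c : (Fin n → ℕ) → κ} (hM : MultP 2 n κ c) :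
    milnorEmbDim 2 n κ c + (polarMatrix (ser 2 n κ c)).rank = n := by
  have h1 := jetTwoColength_add_rank_polarMatrix
    ((FormalCoordChange.two_le_order_iff _).mp (two_le_order_ser hM)).2
  have h2 := (milnorEmbDim_le_and_mod_two hM).2.2
  omega

/-- [OURS · L1 W4.6; NOT a statement of the manuscript] **The polar form of a characteristic-two double
point has EVEN rank** (it is alternating): `rank (polarMatrix a) = n − e(c)` and `e(c) ≡ n (mod 2)`.
[folklore] -/
theorem even_rank_polarMatrix [CharP κ 2] {c : (Fin n → ℕ) → κ} (hM : MultP 2 n κ c) :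
    Even (polarMatrix (ser 2 n κ c)).rank := by
  have h1 := milnorEmbDim_add_rank_polarMatrix hM
  have h2 := (milnorEmbDim_le_and_mod_two hM).2.1
  refine ⟨(polarMatrix (ser 2 n κ c)).rank / 2, ?_⟩
  omega

/-- [OURS · L1 W4.6; NOT a statement of the manuscript] **THE FULL-RANK CRITERIA**: the hyperbolic-
splitting regime `e(c) ≤ 1` is `rank (polarMatrix a) + 1 ≥ n` (corank `≤ 1`), and `e(c) = 0` (resolved by
one blow-up, `μ = 1`) is `rank (polarMatrix a) = n` (NON-DEGENERATE polar form). [folklore] -/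
theorem milnorEmbDim_le_one_iff_rank [CharP κ 2] {c : (Fin n → ℕ) → κ} (hM : MultP 2 n κ c) :
    (milnorEmbDim 2 n κ c ≤ 1 ↔ n ≤ (polarMatrix (ser 2 n κ c)).rank + 1) ∧
      (milnorEmbDim 2 n κ c = 0 ↔ (polarMatrix (ser 2 n κ c)).rank = n) := by
  have h1 := milnorEmbDim_add_rank_polarMatrix hM
  omega

end CampaignW46.HypersurfacesCharTwo

end Summit.ResolutionOfSingularities.ResolutionOfSingularities.Theorems

end
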